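import Literature.Computability.QuantumComplexity.SimonSamplerLaw
import Literature.Computability.QuantumComplexity.PhaseQueryUniform
import Literature.Computability.QuantumComplexity.PromiseWrap
import HarnessLib

/-!
# Simon's algorithm inside a phase-query family, IV: classical pre- and post-processing in `FP`, and white-box Simon problems are in `BQP`

Last file of the quantum half of the discharge of
`Literature.Computability.Complexity.fortnowGrochow_Ker_eq_PEq_UP_subset_BQP` (Fortnow–Grochow 2011,
Thm. 4.3: "finding `w_a` or determining that there is no such string is exactly Daniel Simon's
problem, which is in BQP [Simon 1994]"). The classical wrap (`PromiseWrap.mem_PromiseBQP_of_isQSolvable`;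
Bernstein–Vazirani 1997, §8: deterministic polynomial-time computation is free inside `BQP`) asks for a
pre-processor `h ∈ FP` (the input handed to the quantum family) and a post-processor `g ∈ FP` (reading
`⟨a, measured string⟩`). Part 1, in the brick algebra with total semantics:

* `rawBitsFn : l ↦ rawE bitE l` (a flat string as the raw code of the list of its bits);
* **the pre-processor** `preS Qp Rp a = xin a Q r m` with `Q = Qp(|a|)`, `r = Rp(|a|)`, `m = Q + 2`
  (`preS_mem_FP`);
* the parsing loop `body2`/`loop2` (cut the first `Q` bits of each of the `m` blocks following the
  first `N = |preS a|` symbols, zero-padded, as raw rows; model `pLoop`, `pLoop_snd`, `loop2_rec`);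
* **the post-processor** `postS Qp Rp = progKFn ∘ rows` — the kernel test of `GF2KernelProgram.lean`
  on the sample rows — with **`postS_mem_FP`**, its value `postS_apply : postS ⟨a, w⟩ = [progK (rowsRev a w)]`,
  `rowsRev_eq` (the rows are the sample rows of `SimonSamplerLaw.samples`, reversed) and
  `progK_reverse_rowsOf` (the test decides `MissesBasis`).

Part 2, **`SimonSampler.mem_BQP_of_simonPromise`**: for `F ∈ FP` and polynomials `Q`, `r`, a
language `L` such that `y ↦ F ⟨a, y⟩` on `{0,1}^{Q(|a|)}` has a nonzero xor-mask when `a ∈ L` and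
is injective with values shorter than `r(|a|)` when `a ∉ L` is in `BQP` — the uniform Clifford+`T`
phase-query family of `SimonSamplerSpec.lean` on the padded input (`m = Q + 2` samples in one
register), the classical wrap with `preS`/`postS`, and the two cases of the output law of
`SimonSamplerLaw.lean` (probability `1` on mask instances, error `≤ (2^Q − 1)/2^{Q+2} ≤ 1/3` on
injective ones, `errBound_le`). In the tree's model this is Simon's theorem (Simon 1997, Thm. 3.4 /
§3.1) for functions given by a polynomial-time program rather than by an oracle.

## References

* D. R. Simon, *On the power of quantum computation*, SIAM J. Comput. 26 (1997) 1474–1483, §3.1 and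
  Thm. 3.4 [Simon1997].
* L. Fortnow, J. A. Grochow, *Complexity classes of equivalence problems revisited*, Inform. and
  Comput. 209 (2011) 748–763 = arXiv:0907.4775, Thm. 4.3 (proof) [FortnowGrochow2011].
* E. Bernstein, U. Vazirani, *Quantum complexity theory*, SIAM J. Comput. 26 (1997), §8
  [BernsteinVazirani1997].
* S. Arora, B. Barak, *Computational Complexity: A Modern Approach*, CUP 2009, §1.3 [AroraBarak2009].
-/

noncomputable section

namespace Literature.Computability.QuantumComplexity

open _root_.Computability Polynomial Complexity Complexity.Brick Plumb Cryptography Finset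

namespace SimonSampler

open PhaseQuery SimonBlocks Simon CodeFP


/-! ### A flat bit string as the raw code of the list of its bits -/

/-- The piece of the unpacking fold on `⟨l, 1ᵖ⟩`: `[l_p, l_p, 0, 1]` (the code of the item `[l_p]`). [folklore] -/
def bitPiece4 : List Bool → List Bool :=
  fun z => (HashBricks.headBitFn ∘ bitAtFn ∘ fanoutFn sndF fstF) z ++ ((HashBricks.headBitFn ∘ bitAtFn ∘ fanoutFn sndF fstF) z ++ [false, true])

/-- `bitPiece4 ∈ FP`. [folklore] -/
theorem bitPiece4_mem_FP : bitPiece4 ∈ FP := by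
  have h : (HashBricks.headBitFn ∘ bitAtFn ∘ fanoutFn sndF fstF) ∈ FP :=
    comp_mem_FP HashBricks.headBitFn_mem_FP (comp_mem_FP bitAtFn_mem_FP (fanoutFn_mem_FP sndF_mem_FP fstF_mem_FP))
  exact append_mem_FP h (append_mem_FP h (const_mem_FP _))

/-- Value of `bitPiece4`. [folklore] -/
theorem bitPiece4_apply (l : List Bool) (p : ℕ) : bitPiece4 (boolPair l (ones p)) = [(l.drop p).headD false, (l.drop p).headD false, false, true] := by
  have : (HashBricks.headBitFn ∘ bitAtFn ∘ fanoutFn sndF fstF) (boolPair l (ones p)) = [(l.drop p).headD false] := by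
    simp only [Function.comp_apply, fanoutFn_apply, sndF_boolPair, fstF_boolPair, bitAtFn_boolPair, HashBricks.headBitFn_apply, ones,
      List.length_replicate]
    cases l.drop p <;> simp
  rw [bitPiece4, this]; rfl

/-- `bitPiece4` has length `4`. [folklore] -/
theorem length_bitPiece4 (z : List Bool) : (bitPiece4 z).length = 4 := by
  simp [bitPiece4, HashBricks.headBitFn_apply]

/-- **Unpacking a flat string into the raw list of its bits**: `l ↦ rawE bitE l`. [folklore] -/
def rawBitsFn : List Bool → List Bool :=
  sndPow 2 ∘ foldLoop appF (clipF 4 bitPiece4) X ∘ fanoutFn id (fanoutFn lenBinF (fun _ => boolPair [] []))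

/-- `rawBitsFn ∈ FP`. [folklore] -/
theorem rawBitsFn_mem_FP : rawBitsFn ∈ FP :=
  comp_mem_FP (sndPow_mem_FP 2) (comp_mem_FP (foldLoop_clipF_mem_FP 4 appF_mem_FP length_appF_le bitPiece4_mem_FP X)
    (fanoutFn_mem_FP (PolyTimeComputable.id _) (fanoutFn_mem_FP lenBinF_mem_FP (const_mem_FP _))))

/-- The raw code of the bits of a string, as a concatenation. [folklore] -/
theorem rawE_bitE_eq_ccat (l : List Bool) : rawE bitE l = ccat (fun p => [(l.drop p).headD false, (l.drop p).headD false, false, true]) l.length := by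
  induction l using List.reverseRecOn with
  | nil => rfl
  | append_singleton l b ih =>
    rw [rawE_append, List.length_append, List.length_singleton, ccat_succ,
      ccat_congr (g' := fun p => [(l.drop p).headD false, (l.drop p).headD false, false, true]) (fun p hp => by
        rw [List.drop_append_of_le_length hp.le]
        rcases h : l.drop p with _ | ⟨c, l'⟩
        · have := congrArg List.length h; simp at this; omega
        · rfl), ← ih,
      List.drop_append_of_le_length le_rfl, List.drop_length]
    rfl

/-- **Value of `rawBitsFn`.** [folklore] -/
theorem rawBitsFn_apply (l : List Bool) : rawBitsFn l = rawE bitE l := by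
  have hn : l.length ≤ X.eval l.length := by rw [eval_X]
  rw [rawBitsFn, Function.comp_apply, Function.comp_apply, fanoutFn_apply, fanoutFn_apply, id, lenBinF_apply,
    show (boolPair ([] : List Bool) []) = boolPair (ones 0) ([] : List Bool) by rfl,
    foldLoop_apply _ _ hn, foldAcc_clipF (fun j _ _ => by rw [length_bitPiece4]; omega), foldAcc_appF, rawE_bitE_eq_ccat]
  simp [sndPow, bitPiece4_apply]

/-! ### The pre-processor: the padded input -/

variable (Qp Rp : Polynomial ℕ)

/-- **The parameters at input length `n`**: `Q = Qp n`, `r = Rp n`, `m = Q + 2` samples. [cite: Simon1997, §3.1] -/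
abbrev Qn (n : ℕ) : ℕ := Qp.eval n
/-- `r`. [folklore] -/
abbrev rn (n : ℕ) : ℕ := Rp.eval n
/-- `m = Q + 2`. [folklore] -/
abbrev mn (n : ℕ) : ℕ := Qp.eval n + 2

/-- **The pre-processor**: `a ↦ xin a Q r m` with the parameters of `|a|`. [cite: FortnowGrochow2011, Thm. 4.3 (proof)] -/
def preS (a : List Bool) : List Bool := xin a (Qn Qp a.length) (rn Rp a.length) (mn Qp a.length)

/-- **`preS ∈ FP`.** [cite: AroraBarak2009, §1.3] -/
theorem preS_mem_FP : preS Qp Rp ∈ FP := by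
  have e : preS Qp Rp = fanoutFn id (fanoutFn (polyFn Qp) (fanoutFn (polyFn Rp) (fanoutFn (polyFn (Qp + 2))
      (Kannan.zerosFn ∘ polyFn ((Qp + 2) * (Qp + Rp)))))) := by
    funext a; simp [preS, xin, xcode, fanoutFn_apply, polyFn_apply, Kannan.zerosFn_apply, ones, mn, Qn, rn]
  rw [e]
  exact fanoutFn_mem_FP (PolyTimeComputable.id _) (fanoutFn_mem_FP (polyFn_mem_FP _) (fanoutFn_mem_FP (polyFn_mem_FP _)
    (fanoutFn_mem_FP (polyFn_mem_FP _) (comp_mem_FP Kannan.zerosFn_mem_FP (polyFn_mem_FP _)))))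

/-! ### The post-processor: cut the samples out of the measured string and run the kernel test -/

/-- `1^Q` (record `⟨⟨1^Q, 1^r⟩, ⟨cnt, ⟨rest, acc⟩⟩⟩`). [folklore] -/
def QU2 : List Bool → List Bool := fstF ∘ fstF
/-- `1^r`. [folklore] -/
def RU2 : List Bool → List Bool := sndF ∘ fstF
/-- `1^{Q+r}`. [folklore] -/
def BU2 : List Bool → List Bool := fun z => QU2 z ++ RU2 z
/-- The unread part of the register. [folklore] -/
def REST2 : List Bool → List Bool := nthF 2
/-- The rows collected so far. [folklore] -/
def ACC2 : List Bool → List Bool := sndPow 2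
/-- The next row: the first `Q` unread bits (zero-padded), unpacked. [folklore] -/
def ROW2 : List Bool → List Bool := rawBitsFn ∘ takeFn ∘ fanoutFn QU2 (fun z => REST2 z ++ (Kannan.zerosFn ∘ QU2) z)
/-- **The body of the parsing loop**: emit the row, skip the block. [folklore] -/
def body2 : List Bool → List Bool := fanoutFn (dropFn ∘ fanoutFn BU2 REST2) (fanoutFn ROW2 ACC2)

/-- The accessors are in `FP`. [folklore] -/
theorem QU2_mem_FP : QU2 ∈ FP ∧ RU2 ∈ FP ∧ BU2 ∈ FP ∧ REST2 ∈ FP ∧ ACC2 ∈ FP := by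
  have hQ : QU2 ∈ FP := comp_mem_FP fstF_mem_FP fstF_mem_FP
  have hR : RU2 ∈ FP := comp_mem_FP sndF_mem_FP fstF_mem_FP
  exact ⟨hQ, hR, append_mem_FP hQ hR, nthF_mem_FP 2, sndPow_mem_FP 2⟩

/-- `ROW2 ∈ FP`. [folklore] -/
theorem ROW2_mem_FP : ROW2 ∈ FP := by
  have h1 : (Kannan.zerosFn ∘ QU2) ∈ FP := comp_mem_FP Kannan.zerosFn_mem_FP QU2_mem_FP.1
  exact comp_mem_FP rawBitsFn_mem_FP (comp_mem_FP takeFn_mem_FP (fanoutFn_mem_FP QU2_mem_FP.1 (append_mem_FP QU2_mem_FP.2.2.2.1 h1)))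

/-- **`body2 ∈ FP`.** [folklore] -/
theorem body2_mem_FP : body2 ∈ FP :=
  fanoutFn_mem_FP (comp_mem_FP dropFn_mem_FP (fanoutFn_mem_FP QU2_mem_FP.2.2.1 QU2_mem_FP.2.2.2.1)) (fanoutFn_mem_FP ROW2_mem_FP QU2_mem_FP.2.2.2.2)

/-- Length of the raw code of a bit list. [folklore] -/
theorem length_rawE_bitE (l : List Bool) : (rawE bitE l).length = 4 * l.length := by
  induction l with
  | nil => rfl
  | cons b l ih => rw [rawE_cons, length_boolPair, ih]; simp [bitE]; ring

/-- **Growth of the body**: the rows grow by `4Q + 4 ≤ 8 (|⟨1^Q, 1^r⟩| + 1)` per round, on every input. [folklore] -/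
theorem length_body2_le (z : List Bool) : (body2 z).length ≤ (sndPow 1 z).length + 8 * ((fstF z).length + 1) := by
  rw [body2, fanoutFn_apply, length_boolPair, Function.comp_apply, fanoutFn_apply, dropFn_boolPair, List.length_drop, fanoutFn_apply,
    length_boolPair, ROW2, Function.comp_apply, Function.comp_apply, fanoutFn_apply, takeFn_boolPair, rawBitsFn_apply, length_rawE_bitE,
    List.length_take]
  have h1 : 2 * (REST2 z).length + (ACC2 z).length ≤ (sndPow 1 z).length := length_fstF_sndF_le (sndPow 1 z)
  have h2 : (QU2 z).length ≤ (fstF z).length := by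
    show (fstF (fstF z)).length ≤ _; have := length_fstF_sndF_le (fstF z); omega
  have h3 : min (QU2 z).length ((REST2 z ++ (Kannan.zerosFn ∘ QU2) z).length) ≤ (QU2 z).length := min_le_left _ _
  omega

/-! ### Values on genuine records; the parsing loop -/

/-- The genuine record of the parsing loop. [folklore] -/
def rec2 (Q r : ℕ) (cnt rest acc : List Bool) : List Bool := boolPair (boolPair (ones Q) (ones r)) (boolPair cnt (boolPair rest acc))

/-- The fields of a genuine record. [folklore] -/
theorem fields_rec2 (Q r : ℕ) (cnt rest acc : List Bool) :
    QU2 (rec2 Q r cnt rest acc) = ones Q ∧ RU2 (rec2 Q r cnt rest acc) = ones r ∧ BU2 (rec2 Q r cnt rest acc) = ones (Q + r) ∧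
    REST2 (rec2 Q r cnt rest acc) = rest ∧ ACC2 (rec2 Q r cnt rest acc) = acc := by
  simp [QU2, RU2, BU2, REST2, ACC2, rec2, nthF, sndPow, ones]

/-- **The zero-padded row of `Q` bits** at the front of the unread register. [folklore] -/
def rowQ (Q : ℕ) (rest : List Bool) : List Bool := (rest ++ List.replicate Q false).take Q

/-- **Value of the body on a genuine record.** [folklore] -/
theorem body2_rec (Q r : ℕ) (cnt rest acc : List Bool) :
    body2 (rec2 Q r cnt rest acc) = boolPair (rest.drop (Q + r)) (boolPair (rawE bitE (rowQ Q rest)) acc) := by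
  obtain ⟨hQ, -, hB, hRe, hA⟩ := fields_rec2 Q r cnt rest acc
  rw [body2, fanoutFn_apply, Function.comp_apply, fanoutFn_apply, hB, hRe, dropFn_boolPair, fanoutFn_apply, hA, ROW2, Function.comp_apply,
    Function.comp_apply, fanoutFn_apply, hQ, takeFn_boolPair, rawBitsFn_apply, Function.comp_apply, hQ, hRe, Kannan.zerosFn_apply]
  simp [ones, rowQ]

/-- **The model of the parsing loop**: `k` rounds from the unread bits `rest` and the rows so far. [folklore] -/
def pLoop (Q r : ℕ) : ℕ → List Bool → List (List Bool) → List Bool × List (List Bool)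
  | 0, rest, rows => (rest, rows)
  | k + 1, rest, rows => pLoop Q r k (rest.drop (Q + r)) (rowQ Q rest :: rows)

/-- **The loop runs the model.** [folklore] -/
theorem loopModel_body2 (Q r : ℕ) : ∀ (k : ℕ) (rest : List Bool) (rows : List (List Bool)),
    loopModel body2 (boolPair (ones Q) (ones r)) k (boolPair rest (rawE (rawE bitE) rows)) =
      boolPair (pLoop Q r k rest rows).1 (rawE (rawE bitE) (pLoop Q r k rest rows).2)
  | 0, rest, rows => rfl
  | k + 1, rest, rows => by
    rw [loopModel, show boolPair (boolPair (ones Q) (ones r)) (boolPair (encodeNat (k + 1)) (boolPair rest (rawE (rawE bitE) rows))) =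
      rec2 Q r (encodeNat (k + 1)) rest (rawE (rawE bitE) rows) from rfl, body2_rec, ← rawE_cons, loopModel_body2 Q r k]
    rfl

/-- **The rows in closed form**: the rows of the first `k` blocks, last block first, in front of the given
rows. [folklore] -/
theorem pLoop_snd (Q r : ℕ) : ∀ (k : ℕ) (rest : List Bool) (rows : List (List Bool)),
    (pLoop Q r k rest rows).2 = (List.ofFn fun i : Fin k => rowQ Q (rest.drop (i * (Q + r)))).reverse ++ rows
  | 0, rest, rows => by simp [pLoop]
  | k + 1, rest, rows => by
    rw [pLoop, pLoop_snd Q r k, List.ofFn_succ, List.reverse_cons, List.append_assoc, List.singleton_append]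
    simp only [Fin.val_zero, Nat.zero_mul, List.drop_zero, Fin.val_succ, List.drop_drop, Nat.succ_mul]
    simp only [Nat.add_comm (Q + r) _]

/-- **The parsing loop as a string function.** [cite: AroraBarak2009, §1.3 (bounded loops)] -/
def loop2 : List Bool → List Bool := fun z => (loopStep body2)^[X.eval (fstF z).length] z

/-- `loop2 ∈ FP`. [cite: AroraBarak2009, §1.3] -/
theorem loop2_mem_FP : loop2 ∈ FP := loopFn_mem_FP body2_mem_FP length_body2_le X

/-- **Value of the parsing loop** (enough rounds: `m ≤ 2Q + 2 + r`). [folklore] -/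
theorem loop2_rec {Q r m : ℕ} (hm : m ≤ 2 * Q + 2 + r) (rest : List Bool) (rows : List (List Bool)) :
    loop2 (rec2 Q r (encodeNat m) rest (rawE (rawE bitE) rows)) =
      rec2 Q r [] (pLoop Q r m rest rows).1 (rawE (rawE bitE) (pLoop Q r m rest rows).2) := by
  rw [loop2, rec2, fstF_boolPair, iterate_loopStep _ _ m _ _ (by rw [eval_X, length_boolPair]; simp [ones]; omega), loopModel_body2]
  rfl

/-! ### The post-processor -/

/-- The initial record `⟨⟨1^Q, 1^r⟩, ⟨bin m, ⟨w ⇂ N, ε⟩⟩⟩` built from `⟨a, w⟩` (`N = |preS a|`). [folklore] -/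
def mk2 : List Bool → List Bool :=
  fanoutFn (fanoutFn (polyFn Qp ∘ fstF) (polyFn Rp ∘ fstF))
    (fanoutFn (lenBinF ∘ polyFn (Qp + 2) ∘ fstF) (fanoutFn (dropFn ∘ fanoutFn (preS Qp Rp ∘ fstF) sndF) (fun _ => [])))

/-- `mk2 ∈ FP`. [folklore] -/
theorem mk2_mem_FP : mk2 Qp Rp ∈ FP :=
  fanoutFn_mem_FP (fanoutFn_mem_FP (comp_mem_FP (polyFn_mem_FP _) fstF_mem_FP) (comp_mem_FP (polyFn_mem_FP _) fstF_mem_FP))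
    (fanoutFn_mem_FP (comp_mem_FP lenBinF_mem_FP (comp_mem_FP (polyFn_mem_FP _) fstF_mem_FP))
      (fanoutFn_mem_FP (comp_mem_FP dropFn_mem_FP (fanoutFn_mem_FP (comp_mem_FP (preS_mem_FP Qp Rp) fstF_mem_FP) sndF_mem_FP)) (const_mem_FP _)))

/-- Value of `mk2`. [folklore] -/
theorem mk2_apply (a w : List Bool) :
    mk2 Qp Rp (boolPair a w) = rec2 (Qn Qp a.length) (rn Rp a.length) (encodeNat (mn Qp a.length)) (w.drop (preS Qp Rp a).length) (rawE (rawE bitE) []) := by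
  simp [mk2, rec2, fanoutFn_apply, polyFn_apply, mn, Qn, rn, ones]

/-- A polynomial-time string function computing the kernel test on codes of row lists. [folklore] -/
def progKFn : List Bool → List Bool := Classical.choose GF2Kernel.progKCode

/-- Specification of `progKFn`. [folklore] -/
theorem progKFn_spec : progKFn ∈ FP ∧ ∀ rows : List (List Bool), progKFn (rawE (rawE bitE) rows) = [GF2Kernel.progK rows] :=
  Classical.choose_spec GF2Kernel.progKCode

/-- **The post-processor**: cut the `m` sample rows out of the measured string and run the kernel test.
[cite: Simon1997, §3.1 (the classical post-processing)] -/
def postS : List Bool → List Bool := progKFn ∘ ACC2 ∘ loop2 ∘ mk2 Qp Rp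

/-- **`postS ∈ FP`.** [cite: AroraBarak2009, §1.3] -/
theorem postS_mem_FP : postS Qp Rp ∈ FP :=
  comp_mem_FP progKFn_spec.1 (comp_mem_FP QU2_mem_FP.2.2.2.2 (comp_mem_FP loop2_mem_FP (mk2_mem_FP Qp Rp)))

/-- **The rows handed to the kernel test** on `⟨a, w⟩`: the zero-padded first `Q` bits of the `m` blocks
following the first `N = |preS a|` symbols of `w`, last block first. [folklore] -/
def rowsRev (a w : List Bool) : List (List Bool) :=
  (List.ofFn fun i : Fin (mn Qp a.length) =>
    rowQ (Qn Qp a.length) ((w.drop (preS Qp Rp a).length).drop (i * (Qn Qp a.length + rn Rp a.length)))).reverse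

/-- **Value of the post-processor.** [folklore] -/
theorem postS_apply (a w : List Bool) : postS Qp Rp (boolPair a w) = [GF2Kernel.progK (rowsRev Qp Rp a w)] := by
  rw [postS, Function.comp_apply, Function.comp_apply, Function.comp_apply, mk2_apply,
    loop2_rec (by simp only [mn, Qn, rn]; omega), (fields_rec2 _ _ _ _ _).2.2.2.2, progKFn_spec.2, pLoop_snd, List.append_nil, rowsRev]

/-- The zero-padded row read by positions. [folklore] -/
theorem rowQ_eq_ofFn (Q : ℕ) (l : List Bool) (k : ℕ) : rowQ Q (l.drop k) = List.ofFn fun j : Fin Q => l.getD (k + j) false := by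
  apply List.ext_getElem
  · simp [rowQ]
  · intro j h₁ h₂
    simp only [List.length_ofFn] at h₂
    rw [List.getElem_ofFn]
    simp only [rowQ]
    rw [List.getElem_take]
    by_cases h : j < (l.drop k).length
    · rw [List.getElem_append_left h, List.getElem_drop, List.getD_eq_getElem?_getD,
        List.getElem?_eq_getElem (by simp at h; omega), Option.getD_some]
    · rw [List.getElem_append_right (not_lt.1 h), List.getElem_replicate, List.getD_eq_getElem?_getD,
        List.getElem?_eq_none (by simp at h; omega), Option.getD_none]

/-- **The rows are the sample rows** (`SimonSamplerLaw.samples`), reversed. [folklore] -/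
theorem rowsRev_eq (a w : List Bool) :
    rowsRev Qp Rp a w = (rowsOf (samples (preS Qp Rp a).length (Qn Qp a.length) (rn Rp a.length) (mn Qp a.length) w)).reverse := by
  rw [rowsRev, rowsOf]
  congr 1
  refine congrArg List.ofFn (funext fun i => ?_)
  rw [List.drop_drop, rowQ_eq_ofFn]
  refine congrArg List.ofFn (funext fun j => ?_)
  simp only [samples]
  congr 1
  simp [finProdFinEquiv]
  ring

/-- **The kernel test on the reversed sample rows decides `MissesBasis`** (`m ≥ 1`). [cite: Simon1997, §3.1] -/
theorem progK_reverse_rowsOf {m Q : ℕ} (hm : 1 ≤ m) (y : Fin m → Fin Q → Bool) :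
    GF2Kernel.progK (rowsOf y).reverse = decide (MissesBasis y) := by
  have h := GF2Kernel.progK_eq_true_iff (n := Q) (rows := (rowsOf y).reverse)
    (by intro h0; have := congrArg List.length h0; simp [rowsOf] at this; omega)
    (by intro r hr; rw [List.mem_reverse] at hr; obtain ⟨i, -, rfl⟩ := List.mem_ofFn.1 hr; simp)
  have e : GF2Kernel.HasKernel Q (rowsOf y).reverse ↔ GF2Kernel.HasKernel Q (rowsOf y) := by
    simp only [GF2Kernel.HasKernel, List.mem_reverse]
  rw [e, rowsOf, GF2Kernel.hasKernel_ofFn_iff] at h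
  have e2 : MissesBasis y ↔ ∃ s : Fin Q → Bool, s ≠ (fun _ => false) ∧ ∀ c, Even (Finset.univ.filter fun i => s i && y c i).card := Iff.rfl
  rw [← e2] at h
  by_cases hM : MissesBasis y
  · rw [decide_eq_true hM]; exact h.2 hM
  · rw [decide_eq_false hM]; exact Bool.eq_false_iff.2 fun h' => hM (h.1 h')



/-- The error bound of the injective case with `m = Q + 2` samples is at most `1/3`
(indeed `< 1/4`). [cite: Simon1997, §3.1] -/
theorem errBound_le (Q : ℕ) : ((2 ^ Q - 1) * 2 ^ ((Q - 1) * (Q + 2)) : ℕ) / (2 : ℝ) ^ (Q * (Q + 2)) ≤ 1 / 3 := by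
  rcases Nat.eq_zero_or_pos Q with rfl | hQ
  · simp
  · have hexp : (Q - 1) * (Q + 2) + (Q + 2) = Q * (Q + 2) := by
      obtain ⟨Q', rfl⟩ := Nat.exists_eq_add_of_le' hQ; rw [Nat.add_sub_cancel]; ring
    rw [div_le_iff₀ (by positivity), ← hexp, pow_add]
    have h1 : ((2 ^ Q - 1 : ℕ) : ℝ) ≤ (2 : ℝ) ^ Q := by
      have : (2 ^ Q - 1 : ℕ) ≤ 2 ^ Q := Nat.sub_le _ _
      exact_mod_cast this
    have h2 : (2 : ℝ) ^ (Q + 2) = 2 ^ Q * 4 := by rw [pow_add]; norm_num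
    push_cast [Nat.cast_sub (Nat.one_le_two_pow)]
    rw [h2]
    have h3 : (0 : ℝ) ≤ 2 ^ ((Q - 1) * (Q + 2)) := by positivity
    have h4 : (1 : ℝ) ≤ 2 ^ Q := one_le_pow₀ (by norm_num)
    nlinarith

variable {F : List Bool → List Bool} (Qp Rp : Polynomial ℕ) (L : Language Bool)

/-- The pre-processor is injective: its first field is the instance. [folklore] -/
theorem fstF_preS (a : List Bool) : fstF (preS Qp Rp a) = a := by simp [preS, xcode]

/-- **Simon's theorem for white-box functions, language form.** Let `F ∈ FP` and let `Q(n)`, `r(n)` be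
polynomials. Suppose that for every `a ∈ L` the function `y ↦ F ⟨a, y⟩` on `{0,1}^{Q(|a|)}` is invariant
under a nonzero xor-mask `s_a`, and for every `a ∉ L` it is injective with values shorter than `r(|a|)`.
Then `L ∈ BQP`: on input `a`, run `m = Q + 2` copies of Simon's Fourier sampling on `y ↦ F ⟨a, y⟩` (one
uniform Clifford+`T` phase-query family on the padded input `preS a`), and accept iff the samples do not
span — they never do in the first case (`kernelProb_missesBasis_of_periodic`), and do with probability
`≥ 3/4` in the second (`kernelProb_missesBasis_le_of_injective`, `errBound_le`); the test is Gaussian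
elimination over `GF(2)` (`GF2KernelProgram.lean`), polynomial time, so the classical wrap
(`PromiseWrap.mem_PromiseBQP_of_isQSolvable`) applies. [cite: Simon1997, §3.1 and Thm. 3.4] [cite: FortnowGrochow2011, Thm. 4.3 (proof: "exactly Daniel Simon's problem, which is in BQP")] -/
theorem mem_BQP_of_simonPromise (hF : F ∈ FP)
    (hlen : ∀ a, a ∉ L → ∀ y : Fin (Qp.eval a.length) → Bool, (F (boolPair a (List.ofFn y))).length < Rp.eval a.length)
    (hyes : ∀ a ∈ L, ∃ s : Fin (Qp.eval a.length) → Bool, s ≠ (fun _ => false) ∧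
      ∀ y : Fin (Qp.eval a.length) → Bool, F (boolPair a (List.ofFn fun i => y i ^^ s i)) = F (boolPair a (List.ofFn y)))
    (hno : ∀ a, a ∉ L → ∀ y y' : Fin (Qp.eval a.length) → Bool,
      F (boolPair a (List.ofFn y)) = F (boolPair a (List.ofFn y')) → y = y') :
    L ∈ BQP := by
  rw [← ofLanguage_mem_PromiseBQP_iff]
  -- the search relation: on a genuine padded input, the kernel test gives the right answer
  set R : List Bool → Set (List Bool) := fun x' => {w | ∀ a, x' = preS Qp Rp a →
    (a ∈ L → GF2Kernel.progK (rowsRev Qp Rp a w) = true) ∧ (a ∉ L → GF2Kernel.progK (rowsRev Qp Rp a w) = false)} with hR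
  have hsolv : IsQSolvable R := by
    refine ⟨family (params hF), family_isOracleFree _, family_isUniform _, fun x' => ?_⟩
    by_cases hx : ∃ a, x' = preS Qp Rp a
    · obtain ⟨a, rfl⟩ := hx
      set n := a.length
      have hm : 1 ≤ mn Qp n := by simp only [mn]; omega
      -- the event determined by `a`
      have hRa : ∀ w, w ∈ R (preS Qp Rp a) ↔
          ((a ∈ L → GF2Kernel.progK (rowsRev Qp Rp a w) = true) ∧ (a ∉ L → GF2Kernel.progK (rowsRev Qp Rp a w) = false)) := by
        intro w
        simp only [hR, Set.mem_setOf_eq]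
        constructor
        · intro h; exact h a rfl
        · intro h a' ha'
          have : a' = a := by have := congrArg fstF ha'; rwa [fstF_preS, fstF_preS, eq_comm] at this
          subst this; exact h
      have e : preS Qp Rp a = xin a (Qn Qp n) (rn Rp n) (mn Qp n) := rfl
      have hdec : ∀ w, GF2Kernel.progK (rowsRev Qp Rp a w) =
          decide (MissesBasis (samples (preS Qp Rp a).length (Qn Qp n) (rn Rp n) (mn Qp n) w)) := fun w => by
        rw [rowsRev_eq, progK_reverse_rowsOf hm]
      by_cases ha : a ∈ L
      · -- periodic case: the samples always miss a basis
        obtain ⟨s, hs, hper⟩ := hyes a ha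
        have hg : ∀ y, gHat F a (Qn Qp n) (rn Rp n) (fun i => y i ^^ s i) = gHat F a (Qn Qp n) (rn Rp n) y := fun y => by
          unfold gHat; rw [hper y]
        have h1 := kernelProb_missesBasis_of_periodic hF a (Qn Qp n) (rn Rp n) (mn Qp n) 0 hs hg
        have hsub : {w | MissesBasis (samples (preS Qp Rp a).length (Qn Qp n) (rn Rp n) (mn Qp n) w)} ⊆ R (preS Qp Rp a) := by
          intro w hw
          rw [hRa, hdec]
          exact ⟨fun _ => decide_eq_true hw, fun h => absurd ha h⟩
        have h2 := kernelProb_mono (family (params hF)) 0 (preS Qp Rp a) hsub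
        rw [← e] at h1
        linarith
      · -- injective case: the samples span with probability `≥ 2/3`
        have hinj : Function.Injective (gHat F a (Qn Qp n) (rn Rp n)) := by
          intro y y' h
          have h' := congrArg List.ofFn h
          rw [ofFn_gHat, ofFn_gHat] at h'
          exact hno a ha y y' (codeR_injective (hlen a ha y) (hlen a ha y') h')
        have hb := (kernelProb_missesBasis_le_of_injective hF a (Qn Qp n) (rn Rp n) (mn Qp n) 0 hinj).trans (errBound_le (Qn Qp n))
        have h1 := kernelProb_not_missesBasis hF a (Qn Qp n) (rn Rp n) (mn Qp n) 0 hb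
        have hsub : {w | ¬ MissesBasis (samples (preS Qp Rp a).length (Qn Qp n) (rn Rp n) (mn Qp n) w)} ⊆ R (preS Qp Rp a) := by
          intro w hw
          rw [hRa, hdec]
          exact ⟨fun h => absurd h ha, fun _ => decide_eq_false hw⟩
        have h2 := kernelProb_mono (family (params hF)) 0 (preS Qp Rp a) hsub
        rw [← e] at h1
        linarith
    · -- not a padded input: no constraint
      have hall : R x' = Set.univ := by
        ext w; simp only [hR, Set.mem_setOf_eq, Set.mem_univ, iff_true]
        intro a ha; exact absurd ⟨a, ha⟩ hx
      rw [hall, kernelProb_univ]; norm_num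
  refine mem_PromiseBQP_of_isQSolvable (PromiseProblem.ofLanguage L) (preS Qp Rp) (postS Qp Rp) (preS_mem_FP Qp Rp) (postS_mem_FP Qp Rp)
    hsolv (fun a ha w hw => ?_) (fun a ha w hw => ?_)
  · rw [PromiseProblem.yes_ofLanguage] at ha
    rw [postS_apply, (hw a rfl).1 ha]
  · rw [PromiseProblem.no_ofLanguage] at ha
    rw [postS_apply, (hw a rfl).2 ha]

end SimonSampler

end Literature.Computability.QuantumComplexity
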